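import Summits.Ventures.Crystal3D.Theorems.StickyWulffConstantNoReconstructionGainOffRegistry
import HarnessLib

/-!
# The adhesion atom from a REAL-valued certificate (every normal)

HONEST FRAMING. Part of the venture `Summits/Ventures/Crystal3D` (cell `crystal3d-full`), helper
`--supports` the crux `NoReconstructionGain` (stmt-Ventures-19144, route
`route-Ventures-StickyWulffConstant`), line `adhesion`.  The telescoping reduction of the
R26 certificate line (`cross_le_of_potential`, `…Certificate`) is stated there for INTEGER potentials;
every structural certificate used so far is the order of a REAL function on the film (the `ν`-height
— `noGainPotentialAt_of_registry`; the convex slab gauge — `exists_potential_of_offRegistry`; a layer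
index; a graph distance).  This file records the user-facing form once and for all, at every normal
and in the registered shape of the atom `stub_adhesion`:

* `noGainPotential_rank_iff` — for the rank potential `Φ = #{y ∈ X \ P : f y < f ·}` of a real
  grading `f`, the no-gain inequality (T2) at a film ball `q` is LITERALLY the real-order count
  `2·#{x ∼ q : f x < f q} + #{x ∼ q : f x = f q} + 2·#{p ∈ P : p ∼ q} ≤ 12` (film partners `x`,
  `∼` = distance exactly `1`);
* `adhesion_of_realCertificate` — **the rung** (`R = 1`, `C = 6`): if the film `X \ P` carries a
  real grading `f` and a rim set `E` of at most `ρ` film balls such that the displayed count holds at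
  every film ball off `E`, then `#cross(P, X \ P) ≤ contactDeficiency (X \ P) + 6ρ`.

Proof: rank the film by `f` (`rank_lt_iff`, `rank_eq_iff` of `…OffRegistry`), rewrite (T2) through
`noGainPotential_iff`, telescope with `cross_le_of_potential`.

WHAT THIS IS NOT: existence of a grading for any class of films (each class is its own rung); rung
F-C1 not moved.
-/

noncomputable section

namespace Summit.Ventures.Crystal3D.Theorems

open Summit.Ventures.Crystal3D Finset
open Literature.MathematicalPhysics.StatisticalMechanics (fccStacking orderedContacts contactDeficiency)
open scoped InnerProductSpace

/-- **(T2) for a rank potential is the real-order count.**  `P ⊆ X`, `f` real, `q ∈ X \ P`,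
`Φ y = #{z ∈ X \ P : f z < f y}`: the potential-form no-gain inequality at `q` holds iff
`2·#{x ∈ X \ P : x ∼ q, f x < f q} + #{x ∈ X \ P : x ∼ q, f x = f q} + 2·#{p ∈ P : p ∼ q} ≤ 12`. -/
theorem noGainPotential_rank_iff (X P : Finset (EuclideanSpace ℝ (Fin 3))) (hPX : P ⊆ X)
    (f : EuclideanSpace ℝ (Fin 3) → ℝ) (q : EuclideanSpace ℝ (Fin 3)) (hq : q ∈ X \ P) :
    ((((X \ P).filter fun x => dist q x = 1 ∧
          (((X \ P).filter fun y => f y < f x).card : ℤ) <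
            (((X \ P).filter fun y => f y < f q).card : ℤ)).card : ℤ)
        + ((P.filter fun p => dist q p = 1).card : ℤ)
      ≤ (12 - ((X.filter fun x => dist q x = 1).card : ℤ))
        + (((X \ P).filter fun x => dist q x = 1 ∧
          (((X \ P).filter fun y => f y < f q).card : ℤ) <
            (((X \ P).filter fun y => f y < f x).card : ℤ)).card : ℤ)) ↔
    2 * ((X \ P).filter fun x => dist q x = 1 ∧ f x < f q).card +
      ((X \ P).filter fun x => dist q x = 1 ∧ f x = f q).card +
      2 * (P.filter fun p => dist q p = 1).card ≤ 12 := by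
  classical
  set Φ : EuclideanSpace ℝ (Fin 3) → ℤ := fun x => (((X \ P).filter fun y => f y < f x).card : ℤ)
    with hΦ
  have key := noGainPotential_iff X P hPX Φ q
  simp only [hΦ] at key
  rw [key]
  -- the Φ-below and Φ-level partner sets are the f-below and f-level partner sets
  have hb : ((X \ P).filter fun x => dist q x = 1 ∧
      (((X \ P).filter fun y => f y < f x).card : ℤ) <
        (((X \ P).filter fun y => f y < f q).card : ℤ)) =
      (X \ P).filter fun x => dist q x = 1 ∧ f x < f q := by
    refine filter_congr fun x hx => ?_
    rw [rank_lt_iff (X \ P) f x q hx]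
  have hl : ((X \ P).filter fun x => dist q x = 1 ∧
      (((X \ P).filter fun y => f y < f x).card : ℤ) =
        (((X \ P).filter fun y => f y < f q).card : ℤ)) =
      (X \ P).filter fun x => dist q x = 1 ∧ f x = f q := by
    refine filter_congr fun x hx => ?_
    rw [rank_eq_iff (X \ P) f x q hx hq]
  rw [hb, hl]
  constructor
  · intro h; zify; linarith
  · intro h; zify at h; linarith

/-- **The adhesion atom from a real certificate** (every normal; `R = 1`, `C = 6`; registered by
name on stmt-Ventures-19144).  Around the `ν`-slab sample `P` of `Λ₀`, let the film `X \ P` of a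
finite unit packing `X ⊇ P` carry a real grading `f` and a rim set `E ⊆ X \ P` with `#E ≤ ρ` such
that at every film ball `q ∉ E`
`2·#{x ∈ X \ P : x ∼ q, f x < f q} + #{x ∈ X \ P : x ∼ q, f x = f q} + 2·#{p ∈ P : p ∼ q} ≤ 12`.
Then `#cross(P, X \ P) ≤ contactDeficiency (X \ P) + 6ρ`. -/
theorem adhesion_of_realCertificate :
    ∃ R C : ℝ, 1 ≤ R ∧ ∀ ν : EuclideanSpace ℝ (Fin 3), ‖ν‖ = 1 → ∀ ρ : ℝ, R ≤ ρ →
      ∀ X P : Finset (EuclideanSpace ℝ (Fin 3)),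
      (∀ p ∈ X, ∀ q ∈ X, p ≠ q → 1 ≤ dist p q) → P ⊆ X →
      (∀ p, p ∈ P ↔ (p ∈ fccStacking 1 (Real.sqrt (2 / 3)) ∧ -(2 * R) ≤ ⟪p, ν⟫_ℝ ∧
        ⟪p, ν⟫_ℝ ≤ -R ∧ ‖p‖ ^ 2 - ⟪p, ν⟫_ℝ ^ 2 ≤ ρ ^ 2)) →
      (∃ (f : EuclideanSpace ℝ (Fin 3) → ℝ) (E : Finset (EuclideanSpace ℝ (Fin 3))),
        E ⊆ X \ P ∧ (E.card : ℝ) ≤ ρ ∧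
        ∀ q ∈ (X \ P) \ E,
          2 * ((X \ P).filter fun x => dist q x = 1 ∧ f x < f q).card +
            ((X \ P).filter fun x => dist q x = 1 ∧ f x = f q).card +
            2 * (P.filter fun p => dist q p = 1).card ≤ 12) →
      ((((P ×ˢ (X \ P)).filter fun pq => dist pq.1 pq.2 = 1).card : ℕ) : ℝ) ≤
        contactDeficiency (X \ P) + C * ρ := by
  classical
  refine ⟨1, 6, le_rfl, fun ν _ ρ _ X P hX hPX _ hcert => ?_⟩
  obtain ⟨f, E, hE, hEcard, hT2⟩ := hcert
  set Φ : EuclideanSpace ℝ (Fin 3) → ℤ := fun x => (((X \ P).filter fun y => f y < f x).card : ℤ)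
    with hΦ
  have h := cross_le_of_potential X P E hX hPX hE Φ fun q hq => by
    have hq' : q ∈ X \ P := (mem_sdiff.1 hq).1
    have := (noGainPotential_rank_iff X P hPX f q hq').2 (hT2 q hq)
    simpa only [hΦ] using this
  calc ((((P ×ˢ (X \ P)).filter fun pq => dist pq.1 pq.2 = 1).card : ℕ) : ℝ)
      ≤ contactDeficiency (X \ P) + 6 * (E.card : ℝ) := h
    _ ≤ contactDeficiency (X \ P) + 6 * ρ := by linarith

end Summit.Ventures.Crystal3D.Theorems

end
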